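import Summits.CriticalPhenomena.PercolationContinuityZ3.Theorems.PercNearOneGluingNoHeavyLowerTailAntitheticPieces
import Summits.CriticalPhenomena.PercolationContinuityZ3.Theorems.PercNearOneGluingNoHeavyLowerTailAntitheticSealing
import HarnessLib

/-!
# `NoHeavyLowerTail` (stmt-CriticalPhenomena-4575) — antithetic cluster pairs: ABSTRACT HARRIS CUBES
# (prim-hp-2 gen 50, MEMO-gen50 §1–§2: the certificate theorem of CONJECTURE AC)

Support file (`--supports stmt-CriticalPhenomena-4575`, hull-port prover `prim-hp-2`, gen 50).  No definitions of record, no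
named facts, no sorries; standard axioms.

Setting (MEMO-gen31/49/50): a colouring `ω ⊆ Sym2 V` of the edge set `E` (`ω` red, `ωᶜ` blue), source `s`; the RED vertex cluster
is `openCluster (ω ∩ E) s`, the BLUE one `openCluster (ωᶜ ∩ E) s`; for increasing `F, G : Set V → ℝ` put
`Δ(ω) = (F(red ω) − F(blue ω)) · (G(red ω) − G(blue ω))`.  The vertex form of the lineage's CONJECTURE BIC asserts
`0 ≤ Σ_{ω ∈ D} Δ(ω)` for the constraint sets `D = D(R)` ("no vertex of `R` in both clusters").

ABSTRACT CUBES (MEMO-gen50 §1).  A family `β : Set ι → Set (Sym2 V)` indexed by the subsets of a finite set is an ABSTRACT CUBE if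
(i) the red cluster of `β S` is monotone in `S` and (ii) the red cluster of `β Sᶜ` is the blue cluster of `β S` ("the opposite slot
carries the complementary colouring, as far as the clusters of `s` are concerned").  The members need NOT be block flips
`η ∆ ⋃_{i∈S} B_i` of one colouring (the pieces of gens 32–49), and `β` need not be injective.  Harris' inequality on the cube gives
`0 ≤ Σ_S Δ(β S)` (`Antithetic.cube_sum_nonneg`, from `Antithetic.piece_abstract`), and any family of abstract cubes with nonnegative
rational weights whose weighted multiplicities add up to `1` on every colouring of `D` certifies `0 ≤ Σ_{ω∈D} Δ(ω)`
(`Antithetic.sum_nonneg_of_weighted_cover`, `Antithetic.sum_nonneg_of_cubes`).  MEMO-gen50 §3–§4: such certificates with cubes of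
dimension ≤ 3 exist for every `(G,s,R)` with `|V| ≤ 5, |E| ≤ 6` except the 4-star (which is one 4-cube), for `K₄−e+x` with the apex
source — where no cover by block-flip cubes exists (MEMO-gen49 §9) — and for the gen-49 'no VC cover' classes tested.

* `Antithetic.cube_sum_nonneg` — the abstract cube lemma (vertex clusters); `Antithetic.cube_edge_sum_nonneg` — edge clusters.
* `Antithetic.sum_nonneg_of_weighted_cover` — the weighted cover principle (fractional version of `sum_nonneg_of_parts`).
* `Antithetic.sum_nonneg_of_cubes` — the two combined: an ABSTRACT-CUBE CERTIFICATE proves the antithetic sum over `D` nonnegative.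
* `Antithetic.bleach_red_subset`, `Antithetic.bleach_blue_supset`, `Antithetic.bleach_sandwich` — the SANDWICH LEMMA (MEMO-gen50 §2 (L1)):
  flipping every edge of `E` that meets a red-only vertex ("bleaching the red lobes") turns ANY colouring `T` into a NESTED one `x`
  (red cluster ⊆ `W ∩ W'`, blue cluster ⊇ `W ∪ W'`) that sandwiches `T` in the twisted order (`x ≼ T ≼ xᶜ`) and whose doubly reached
  vertices are doubly reached in `T`; so every crossing configuration of `D(R)` has a canonical 2-cube partner inside `D(R)`.
[cite: VandenbergHaggstromKahn2005, §1 p. 6 ("Harris' inequality")]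
-/

noncomputable section

namespace Summit.CriticalPhenomena.PercolationContinuityZ3.Theorems

open Literature.Probability.Percolation
open scoped Classical symmDiff

namespace Antithetic

section Cube

variable {V : Type*} {ι : Type*} [Fintype ι]

/-- **Abstract cube lemma (vertex clusters).**  Let `β : Set ι → Set (Sym2 V)` be a family of colourings indexed by the subsets of a
finite set such that (i) the red vertex cluster `openCluster (β S ∩ E) s` is monotone in `S` and (ii) for every `S` the red cluster of
`β Sᶜ` equals the blue cluster of `β S`.  Then for increasing `F, G : Set V → ℝ`,
`0 ≤ Σ_S (F(red β S) − F(blue β S)) · (G(red β S) − G(blue β S))` — Harris' inequality on the cube `Set ι`; the members need not be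
block flips of one colouring and `β` need not be injective (MEMO-gen50 §1(1b)).
[cite: VandenbergHaggstromKahn2005, §1 p. 6 ("Harris' inequality")] -/
theorem cube_sum_nonneg (E : Set (Sym2 V)) (s : V) (β : Set ι → Set (Sym2 V))
    (hmono : Monotone fun S => openCluster (β S ∩ E) s)
    (hopp : ∀ S, openCluster (β Sᶜ ∩ E) s = openCluster ((β S)ᶜ ∩ E) s)
    {F G : Set V → ℝ} (hF : Monotone F) (hG : Monotone G) :
    0 ≤ ∑ S : Set ι, (F (openCluster (β S ∩ E) s) - F (openCluster ((β S)ᶜ ∩ E) s)) *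
      (G (openCluster (β S ∩ E) s) - G (openCluster ((β S)ᶜ ∩ E) s)) := by
  -- Φ S := red cluster of the opposite slot β Sᶜ (= blue cluster of β S); antitone in S.
  have hanti : Antitone fun S : Set ι => openCluster (β Sᶜ ∩ E) s := fun S S' h =>
    hmono (Set.compl_subset_compl.2 h)
  have h := piece_abstract (fun S : Set ι => openCluster (β Sᶜ ∩ E) s) hanti hF hG
  refine h.trans_eq (Finset.sum_congr rfl fun S _ => ?_)
  simp only [compl_compl, hopp S]
  ring

/-- **Abstract cube lemma (edge clusters)**: the same statement for BHK's open EDGE clusters `C_s` and increasing functions of the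
edge cluster. [cite: VandenbergHaggstromKahn2005, §1 p. 3 (open cluster `C_s`), p. 6 ("Harris' inequality")] -/
theorem cube_edge_sum_nonneg (E : Set (Sym2 V)) (s : V) (β : Set ι → Set (Sym2 V))
    (hmono : Monotone fun S => openEdgeCluster (β S ∩ E) s)
    (hopp : ∀ S, openEdgeCluster (β Sᶜ ∩ E) s = openEdgeCluster ((β S)ᶜ ∩ E) s)
    {F G : Set (Sym2 V) → ℝ} (hF : Monotone F) (hG : Monotone G) :
    0 ≤ ∑ S : Set ι, (F (openEdgeCluster (β S ∩ E) s) - F (openEdgeCluster ((β S)ᶜ ∩ E) s)) *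
      (G (openEdgeCluster (β S ∩ E) s) - G (openEdgeCluster ((β S)ᶜ ∩ E) s)) := by
  have hanti : Antitone fun S : Set ι => openEdgeCluster (β Sᶜ ∩ E) s := fun S S' h =>
    hmono (Set.compl_subset_compl.2 h)
  have h := piece_abstract (fun S : Set ι => openEdgeCluster (β Sᶜ ∩ E) s) hanti hF hG
  refine h.trans_eq (Finset.sum_congr rfl fun S _ => ?_)
  simp only [compl_compl, hopp S]
  ring

end Cube

section Cover

variable {κ π : Type*}

/-- **Weighted cover principle.**  If nonnegative weights `w i` on "pieces" `i ∈ P`, each piece being a multiplicity function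
`c i : κ → ℕ` supported in `D`, reproduce the counting measure of `D` (`Σ_i w i · c i z = 1` for `z ∈ D`), and every piece has a
nonnegative `Ψ`-sum `Σ_{z∈D} c i z · Ψ z ≥ 0`, then `Σ_{z∈D} Ψ z ≥ 0`.  (Fractional form of the partition principle
`sum_nonneg_of_parts` of gen 36.) [folklore] -/
theorem sum_nonneg_of_weighted_cover (D : Finset κ) (Ψ : κ → ℝ) (P : Finset π) (w : π → ℝ) (c : π → κ → ℕ)
    (hw : ∀ i ∈ P, 0 ≤ w i) (hcover : ∀ z ∈ D, ∑ i ∈ P, w i * (c i z : ℝ) = 1)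
    (hpos : ∀ i ∈ P, 0 ≤ ∑ z ∈ D, (c i z : ℝ) * Ψ z) : 0 ≤ ∑ z ∈ D, Ψ z := by
  have key : ∑ z ∈ D, Ψ z = ∑ i ∈ P, w i * ∑ z ∈ D, (c i z : ℝ) * Ψ z := by
    calc ∑ z ∈ D, Ψ z = ∑ z ∈ D, (∑ i ∈ P, w i * (c i z : ℝ)) * Ψ z := by
            refine Finset.sum_congr rfl fun z hz => ?_
            rw [hcover z hz, one_mul]
      _ = ∑ z ∈ D, ∑ i ∈ P, w i * ((c i z : ℝ) * Ψ z) := by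
            refine Finset.sum_congr rfl fun z _ => ?_
            rw [Finset.sum_mul]
            refine Finset.sum_congr rfl fun i _ => ?_
            ring
      _ = ∑ i ∈ P, ∑ z ∈ D, w i * ((c i z : ℝ) * Ψ z) := Finset.sum_comm
      _ = ∑ i ∈ P, w i * ∑ z ∈ D, (c i z : ℝ) * Ψ z := by
            refine Finset.sum_congr rfl fun i _ => ?_
            rw [Finset.mul_sum]
  rw [key]
  exact Finset.sum_nonneg fun i hi => mul_nonneg (hw i hi) (hpos i hi)

/-- The `Ψ`-sum of a piece presented as a MAP `β : σ → κ` (e.g. an abstract cube `Set ι → colourings`) with all values in `D`,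
counted with multiplicity `c z = #{S : β S = z}`, is the plain sum `Σ_S Ψ(β S)`. [folklore] -/
theorem sum_mult_eq_sum_map {σ : Type*} [Fintype σ] (D : Finset κ) (Ψ : κ → ℝ) (β : σ → κ) (hβ : ∀ S, β S ∈ D) :
    ∑ z ∈ D, ((Finset.univ.filter fun S => β S = z).card : ℝ) * Ψ z = ∑ S, Ψ (β S) := by
  symm
  rw [← Finset.sum_fiberwise_of_maps_to (s := Finset.univ) (t := D) (g := β) fun S _ => hβ S]
  refine Finset.sum_congr rfl fun z _ => ?_
  rw [Finset.sum_congr rfl fun S (hS : S ∈ Finset.univ.filter fun S => β S = z) => by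
      rw [(Finset.mem_filter.1 hS).2]]
  rw [Finset.sum_const, nsmul_eq_mul]

/-- **Abstract-cube certificates prove the antithetic inequality on `D`.**  Let `D` be a finite set of colourings and `Ψ` any real
function on colourings (e.g. `Δ_{F,G}`).  Suppose pieces `i ∈ P`, each an indexed family `β i : Set (ι i) → colourings` with values
in `D` and nonnegative piece-sum `Σ_S Ψ(β i S) ≥ 0` (for abstract cubes: `cube_sum_nonneg`), carry weights `w i ≥ 0` with
`Σ_i w i · #{S : β i S = z} = 1` for every `z ∈ D`.  Then `0 ≤ Σ_{z∈D} Ψ z` (MEMO-gen50 §1, certificate theorem (L3)). [this work] -/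
theorem sum_nonneg_of_cubes (D : Finset κ) (Ψ : κ → ℝ) (P : Finset π) (ι : π → Type*) [∀ i, Fintype (ι i)]
    (β : ∀ i, Set (ι i) → κ) (w : π → ℝ) (hw : ∀ i ∈ P, 0 ≤ w i) (hD : ∀ i ∈ P, ∀ S, β i S ∈ D)
    (hcover : ∀ z ∈ D, ∑ i ∈ P, w i * ((Finset.univ.filter fun S => β i S = z).card : ℝ) = 1)
    (hpos : ∀ i ∈ P, 0 ≤ ∑ S : Set (ι i), Ψ (β i S)) : 0 ≤ ∑ z ∈ D, Ψ z := by
  refine sum_nonneg_of_weighted_cover D Ψ P w (fun i z => (Finset.univ.filter fun S => β i S = z).card) hw hcover ?_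
  intro i hi
  rw [sum_mult_eq_sum_map D Ψ (β i) (hD i hi)]
  exact hpos i hi

end Cover

section Bleach

variable {V : Type*}

/-- **Sandwich lemma, red side** (MEMO-gen50 §2 (L1)).  Let `W = openCluster (T ∩ E) s` (red cluster), `W' = openCluster (Tᶜ ∩ E) s`
(blue cluster), and let `x` be `T` flipped on every edge of `E` meeting a red-only vertex (a vertex of `W ∖ W'`).  Then the red cluster of
`x` lies inside the core `W ∩ W'`: no `x`-red edge of `E` leaves the core (an edge to a red-only vertex was red, hence is now blue; an edge
to any other outside vertex does not meet `W ∖ W'`, keeps its colour, and a red one would put its endpoint in `W`). [this work] -/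
theorem bleach_red_subset (E T : Set (Sym2 V)) (s : V) :
    openCluster ((T ∆ {e | e ∈ E ∧ ∃ v ∈ e, v ∈ openCluster (T ∩ E) s ∧ v ∉ openCluster (Tᶜ ∩ E) s}) ∩ E) s ⊆
      openCluster (T ∩ E) s ∩ openCluster (Tᶜ ∩ E) s := by
  set W := openCluster (T ∩ E) s with hW
  set W' := openCluster (Tᶜ ∩ E) s with hW'
  set Fl := {e | e ∈ E ∧ ∃ v ∈ e, v ∈ W ∧ v ∉ W'} with hFl
  set x := T ∆ Fl with hx
  -- the core is sealed against x-red edges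
  have hseal : ∀ a b, a ∉ (W ∩ W')ᶜ → b ∈ (W ∩ W')ᶜ → s(a, b) ∉ x ∩ E := by
    intro a b ha hb hab
    have ha' : a ∈ W ∩ W' := not_not.1 ha
    obtain ⟨habx, habE⟩ := hab
    rw [Set.mem_symmDiff] at habx
    by_cases hbM : b ∈ W ∧ b ∉ W'
    · -- edge meets a red-only vertex: it lies in Fl, so x-red means T-blue; then b would be blue
      have hFlab : s(a, b) ∈ Fl := ⟨habE, b, Sym2.mem_mk_right a b, hbM⟩
      have hTab : s(a, b) ∉ T := by
        rcases habx with ⟨_, h⟩ | ⟨_, h⟩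
        · exact absurd hFlab h
        · exact h
      have hblue : (openGraph (Tᶜ ∩ E)).Adj a b := by
        rw [openGraph_adj]
        refine ⟨⟨hTab, habE⟩, ?_⟩
        rintro rfl
        exact hbM.2 ha'.2
      exact hbM.2 (ha'.2.trans hblue.reachable)
    · -- edge misses W \ W': colour unchanged; red would put b in W, then b ∈ W' too (else b red-only), contradiction with b ∉ core
      have hnotFl : s(a, b) ∉ Fl := by
        rintro ⟨_, v, hv, hvW, hvW'⟩
        rcases Sym2.mem_iff.1 hv with rfl | rfl
        · exact hvW' ha'.2
        · exact hbM ⟨hvW, hvW'⟩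
      have hTab : s(a, b) ∈ T := by
        rcases habx with ⟨h, _⟩ | ⟨h, _⟩
        · exact h
        · exact absurd h hnotFl
      have hred : (openGraph (T ∩ E)).Adj a b := by
        rw [openGraph_adj]
        refine ⟨⟨hTab, habE⟩, ?_⟩
        rintro rfl
        exact hb ha'
      have hbW : b ∈ W := ha'.1.trans hred.reachable
      have hbW' : b ∈ W' := by
        by_contra h
        exact hbM ⟨hbW, h⟩
      exact hb ⟨hbW, hbW'⟩
  intro v hv
  have hs : s ∉ (W ∩ W')ᶜ := fun h => h ⟨mem_openCluster_self _ _, mem_openCluster_self _ _⟩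
  have := (reachable_of_sealed (x ∩ E) (x ∩ E) s (W ∩ W')ᶜ hs (fun _ _ _ _ => Iff.rfl) hseal hv).2
  exact not_not.1 this

/-- **Sandwich lemma, blue side** (MEMO-gen50 §2 (L1)).  With the notation of `bleach_red_subset`, the blue cluster of `x` contains
`W ∪ W'`: a blue path of `T` never touches a red-only vertex, so it stays blue; and a red-only vertex is reached by a red `T`-path whose
final stretch inside `W ∖ W'` has been flipped to blue and starts at a core vertex, which is blue-reached. [this work] -/
theorem bleach_blue_supset (E T : Set (Sym2 V)) (s : V) :
    openCluster (T ∩ E) s ∪ openCluster (Tᶜ ∩ E) s ⊆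
      openCluster ((T ∆ {e | e ∈ E ∧ ∃ v ∈ e, v ∈ openCluster (T ∩ E) s ∧ v ∉ openCluster (Tᶜ ∩ E) s})ᶜ ∩ E) s := by
  set W := openCluster (T ∩ E) s with hW
  set W' := openCluster (Tᶜ ∩ E) s with hW'
  set Fl := {e | e ∈ E ∧ ∃ v ∈ e, v ∈ W ∧ v ∉ W'} with hFl
  set x := T ∆ Fl with hx
  -- (1) blue T-walks from s stay blue in x
  have hblue_walk : ∀ {a v : V} (_ : (openGraph (Tᶜ ∩ E)).Walk a v), a ∈ W' → (openGraph (xᶜ ∩ E)).Reachable s a →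
      (openGraph (xᶜ ∩ E)).Reachable s v := by
    intro a v p
    induction p with
    | nil => exact fun _ h => h
    | @cons a b c hab _ ih =>
      intro haW' hsa
      rw [openGraph_adj] at hab
      have hbW' : b ∈ W' := haW'.trans ((openGraph_adj _ a b).2 hab).reachable
      have hnotFl : s(a, b) ∉ Fl := by
        rintro ⟨_, v, hv, _, hvW'⟩
        rcases Sym2.mem_iff.1 hv with rfl | rfl
        · exact hvW' haW'
        · exact hvW' hbW'
      have hxab : s(a, b) ∈ xᶜ ∩ E := by
        refine ⟨?_, hab.1.2⟩
        rw [hx, Set.mem_compl_iff, Set.mem_symmDiff]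
        push Not
        exact ⟨fun h => absurd h hab.1.1, fun h => absurd h hnotFl⟩
      have hadj : (openGraph (xᶜ ∩ E)).Adj a b := (openGraph_adj _ a b).2 ⟨hxab, hab.2⟩
      exact ih hbW' (hsa.trans hadj.reachable)
  have hW'sub : W' ⊆ openCluster (xᶜ ∩ E) s := by
    intro v hv
    obtain ⟨p⟩ := hv
    exact hblue_walk p (mem_openCluster_self _ _) (SimpleGraph.Reachable.refl s)
  -- (2) red T-walks from s: every vertex is blue-reached in x
  have hred_walk : ∀ {a v : V} (_ : (openGraph (T ∩ E)).Walk a v), a ∈ W → (openGraph (xᶜ ∩ E)).Reachable s a →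
      (openGraph (xᶜ ∩ E)).Reachable s v := by
    intro a v p
    induction p with
    | nil => exact fun _ h => h
    | @cons a b c hab _ ih =>
      intro haW hsa
      rw [openGraph_adj] at hab
      have hbW : b ∈ W := haW.trans ((openGraph_adj _ a b).2 hab).reachable
      by_cases hbW' : b ∈ W'
      · exact ih hbW (hW'sub hbW')
      · -- b is red-only: the edge meets W \ W', so it is flipped to blue in x
        have hFlab : s(a, b) ∈ Fl := ⟨hab.1.2, b, Sym2.mem_mk_right a b, hbW, hbW'⟩
        have hxab : s(a, b) ∈ xᶜ ∩ E := by
          refine ⟨?_, hab.1.2⟩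
          rw [hx, Set.mem_compl_iff, Set.mem_symmDiff]
          push Not
          exact ⟨fun _ => hFlab, fun _ => hab.1.1⟩
        have hadj : (openGraph (xᶜ ∩ E)).Adj a b := (openGraph_adj _ a b).2 ⟨hxab, hab.2⟩
        exact ih hbW (hsa.trans hadj.reachable)
  intro v hv
  rcases hv with hv | hv
  · obtain ⟨p⟩ := hv
    exact hred_walk p (mem_openCluster_self _ _) (SimpleGraph.Reachable.refl s)
  · exact hW'sub hv

/-- **SANDWICH LEMMA** (MEMO-gen50 §2 (L1)): the bleached colouring `x` of `T` is NESTED (its red cluster lies inside its blue cluster),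
it sandwiches `T` in the twisted order — `red x ⊆ red T`, `blue x ⊇ blue T`, `red T ⊆ blue x`, `blue T ⊇ red x` (so `x ≼ T ≼ xᶜ`) — and
every vertex in both clusters of `x` is in both clusters of `T` (so `x ∈ D(R)` whenever `T ∈ D(R)`).  Hence `{x, xᶜ, T, Tᶜ}` is an abstract
2-cube for every crossing `T`. [this work] -/
theorem bleach_sandwich (E T : Set (Sym2 V)) (s : V) :
    let W := openCluster (T ∩ E) s
    let W' := openCluster (Tᶜ ∩ E) s
    let x := T ∆ {e | e ∈ E ∧ ∃ v ∈ e, v ∈ W ∧ v ∉ W'}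
    openCluster (x ∩ E) s ⊆ openCluster (xᶜ ∩ E) s ∧
      openCluster (x ∩ E) s ⊆ W ∧ W' ⊆ openCluster (xᶜ ∩ E) s ∧
      W ⊆ openCluster (xᶜ ∩ E) s ∧ openCluster (x ∩ E) s ⊆ W' ∧
      openCluster (x ∩ E) s ∩ openCluster (xᶜ ∩ E) s ⊆ W ∩ W' := by
  intro W W' x
  have hr := bleach_red_subset E T s
  have hb := bleach_blue_supset E T s
  refine ⟨fun v hv => hb (Or.inl (hr hv).1), fun v hv => (hr hv).1, fun v hv => hb (Or.inr hv), fun v hv => hb (Or.inl hv),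
    fun v hv => (hr hv).2, fun v hv => hr hv.1⟩

end Bleach

end Antithetic

end Summit.CriticalPhenomena.PercolationContinuityZ3.Theorems
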